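import Summits.AtomisticToContinuum.Crystallization.Cruxes.TruncatedCensusGap.IdeatorThreeSketch
import Summits.AtomisticToContinuum.Crystallization.Theorems.TruncatedCensusGap.Negative.KappaZeroHalf

/-!
# Crux-triage r1 k=2 scratch — cheap Lean attacks on the ideator-3 first lemmas
(crux `stmt-AtomisticToContinuum-14230`, `TruncatedCensusGap`).

1. `slackStability_of_bddBelow` : the Lean stub `Sketch.SlackStability` (card gap-distance-slack,
   "the energy-side crux in checkable form") is VACUOUS modulo periodic stability: with `W = ∅`
   (or any `a ≥ 500`) its shape constraint reads `0 ≤ P r`, so `P = 0` satisfies it and the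
   statement collapses to `BddBelow (range e_χ)`; in particular it follows from the crux itself
   (`slackStability_of_tcg`, via the landed `truncatedCensusGap_bddBelow`).
2. `slackGivesPairLocalBound_holds` : the card's first lemma is TRUE (bookkeeping: additivity of
   the pair energy in the potential + the landed finite-range trial-state bound
   `iInf_energyPerParticle_le_div`).
3. `pointwisePricedLocalisationGivesGap_holds` : card sharp-m-potential-compactness's shape
   statement is TRUE (bookkeeping), confirming that all content of that card is the EXISTENCE of
   the sharp localisation `h` (its Transfer `C⁺(R)`), none in the implication.
-/

noncomputable section

namespace Summit.AtomisticToContinuum.Crystallization.Cruxes.TruncatedCensusGap.Triage2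

open Literature.MathematicalPhysics.StatisticalMechanics Literature.Geometry.DiscreteGeometry
open Summit.AtomisticToContinuum.Crystallization.Theses.PricedLinkCensus (TruncatedCensusGap)
open Summit.AtomisticToContinuum.Crystallization.Cruxes.TruncatedCensusGap.Sketch
open Summit.AtomisticToContinuum.Crystallization.Theorems

theorem Vχ_eq : Vχ = fun r => min 1 (max 0 (4 - 2 * r)) * lennardJones r := rfl

theorem Vχ_eq_zero_of_two_le (r : ℝ) (hr : 2 ≤ r) : Vχ r = 0 := truncLJ_eq_zero_of_two_le r hr

/-- The pair energy is additive in the potential. -/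
theorem interactionEnergy_sub (V P : ℝ → ℝ) {N : ℕ} (y : Fin N → EuclideanSpace ℝ (Fin 3)) :
    interactionEnergy (fun r => V r - P r) y = interactionEnergy V y - interactionEnergy P y := by
  simp [interactionEnergy, Finset.sum_sub_distrib]

/-! ## 1. `SlackStability` as typed is vacuous modulo `BddBelow` -/

theorem slackStability_of_bddBelow
    (hB : BddBelow (Set.range fun Q : PeriodicConfiguration 3 => Q.energyPerParticle Vχ)) :
    SlackStability := by
  refine ⟨fun _ => 0, 1, 1, ∅, one_pos, one_pos, by simp, continuous_const, fun _ => le_rfl,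
    fun _ _ => rfl, ?_, ?_, ?_⟩
  · intro r _ _
    have hI : IsEmpty {x : ℝ // x ∈ (∅ : Finset ℝ)} := ⟨fun w => Finset.notMem_empty w.1 w.2⟩
    have h0 : (⨅ w : {x : ℝ // x ∈ (∅ : Finset ℝ)}, max 0 (|r - (w : ℝ)| - 1 / 250)) = 0 :=
      @Real.iInf_of_isEmpty _ hI _
    rw [h0]
    norm_num
  · simpa using hB
  · simp [eStar]

/-- Hence the crux itself already gives `SlackStability` (with the useless witness `P = 0`). -/
theorem slackStability_of_tcg (h : TruncatedCensusGap) : SlackStability :=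
  slackStability_of_bddBelow (by simpa [Vχ_eq] using truncatedCensusGap_bddBelow h)

/-! ## 2. The first lemma of card gap-distance-slack holds -/

theorem slackGivesPairLocalBound_holds : SlackGivesPairLocalBound := by
  intro P hP0 hP2 hB hinf N y hy
  rcases Nat.eq_zero_or_pos N with rfl | hN
  · simp [interactionEnergy]
  have hV : ∀ r, 2 ≤ r → (fun r => Vχ r - P r) r = 0 := fun r hr => by
    simp [Vχ_eq_zero_of_two_le r hr, hP2 r hr]
  have h := iInf_energyPerParticle_le_div hV hB hy hN
  rw [hinf, le_div_iff₀ (by exact_mod_cast hN), interactionEnergy_sub] at h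
  linarith

/-! ## 3. The shape statement of card sharp-m-potential-compactness holds -/

theorem pointwisePricedLocalisationGivesGap_holds : PointwisePricedLocalisationGivesGap := by
  intro h κ₀ hκ₀ hsum hnn hch
  refine ⟨κ₀, hκ₀, fun N y hy => ?_⟩
  classical
  -- the charged sites as a Finset
  set S : Finset (Fin N) := Finset.univ.filter fun i => ¬ IsChargeFree (1 / 100 : ℝ) y i with hS
  have hcard : (Nat.card {i : Fin N // ¬ IsChargeFree (1 / 100 : ℝ) y i} : ℝ) = S.card := by
    rw [Nat.card_eq_fintype_card, Fintype.card_subtype, hS]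
  have h1 : κ₀ * (S.card : ℝ) ≤ ∑ i ∈ S, h N y i := by
    have : ∑ _i ∈ S, κ₀ ≤ ∑ i ∈ S, h N y i :=
      Finset.sum_le_sum fun i hi => hch N y i hy (Finset.mem_filter.1 hi).2
    simpa [mul_comm] using this
  have h2 : ∑ i ∈ S, h N y i ≤ ∑ i, h N y i :=
    Finset.sum_le_univ_sum_of_nonneg fun i => hnn N y i hy
  have h3 := hsum N y hy
  show (N : ℝ) * eStar + κ₀ * _ ≤ interactionEnergy Vχ y
  rw [hcard]
  linarith

end Summit.AtomisticToContinuum.Crystallization.Cruxes.TruncatedCensusGap.Triage2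

end
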